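import Summits.AtomisticToContinuum.BoseEinsteinCondensation.Theorems.BECSwapNoCatastropheAbsTorusDefs
import Literature.MathematicalPhysics.QuantumManyBody.PeriodicWeightedMaxFormGroundStates
import Summits.AtomisticToContinuum.BoseEinsteinCondensation.Theorems.BECInsertionCorrectorStaticResponseBoundTruncationMonotone
import HarnessLib

/-!
# Crux `TorusHalfSwapOverlap` (stmt-AtomisticToContinuum-14393), line `registered` (skeleton v7 = truncation
# split) — stub C `stub_absLimitProfile`: the absolute limit profile

The COMPACTNESS HALF of B. Simon's monotone convergence theorem for the forms
`q_m(Ψ) = ∫_cell |∇Ψ|² + W_m |Ψ|²` on the absolute class `AbsAdm N L` of plain `C¹` periodic `N`-body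
functions, along a measurable increasing tower `W_m ↑ W_∞` of abstract weights `Config N → [0, ∞]` (hard
cores allowed in `W_∞`): if the infima `E_m = absGroundStateEnergyW (W m) L` stay bounded there is a unit
vector `η ∈ L²((ℝ/ℤ)^{3N})` whose MAXIMAL-form energy `maxFormW W_∞ L η = maxFormKin L η + maxFormPotW W_∞ L η`
is `≤ ⨆ₘ E_m`.

The two hypotheses of the registered statement are the registered statements of the neighbouring stubs
D (the dictionary `Ψ ↦ η_Ψ = L^{3N/2} (Ψ ∘ fromUnitTorusN L)`: cell norm, `maxFormKin = ∫ |∇Ψ|²`,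
`maxFormPotW W = ∫ W |Ψ|²`) and R (scalar Rellich: sequences bounded in `L²` with bounded spectral kinetic
energy have convergent subsequences); they are ASSUMED here. The proof is the proof of
`exists_limitProfile_family` (crux `PeriodicIRBound`) with the transport `formEmbed ∘ graphEmbed` replaced by
D and `isCompactOperator_formEmbed` replaced by R: near-minimisers `Ψ m` of the truncated problems, the
Rellich subsequence `η_{Ψ(φ i)} → η`, an a.e.-convergent further subsequence, `‖η‖ = 1` by continuity of the
norm, lower semicontinuity of the kinetic part (`maxFormKin_le_liminf`), Fatou for the potential part at a
FIXED height `m'` along `i ≥ m'` (monotone tower), and Beppo Levi in the height.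

References: [ReedSimonIV1978] Thm XIII.64; B. Simon, *J. Funct. Anal.* 28 (1978) 377–385 (monotone convergence
of forms); B. Simon, *J. Operator Theory* 1 (1979) 37–47 (maximal and minimal forms).
-/

noncomputable section

namespace Summit.AtomisticToContinuum.BoseEinsteinCondensation.Cruxes.TorusHalfSwapOverlap.TruncationSplit

open MeasureTheory Filter Topology
open scoped ENNReal NNReal InnerProductSpace ComplexConjugate
open Literature.MathematicalPhysics.QuantumManyBody.BoseGas
open Summit.AtomisticToContinuum.BoseEinsteinCondensation.AbsTorus
open Summit.AtomisticToContinuum.BoseEinsteinCondensation.Cruxes.StaticResponseBound.UvThomsonForceWave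
  (mul_liminf_le)

-- The measure on `ℝ/ℤ` is the Haar PROBABILITY measure, as in `PeriodicFormDomain.lean` (so that
-- `Lp ℂ 2 (volume : Measure (UnitAddTorus (Fin N × Fin 3)))` is the space on which `maxFormKin` / `maxFormW` live).
attribute [local instance] formDomain_measureSpace formDomain_isProbabilityMeasure formDomain_isProbabilityMeasure_pi

/-- **Stub C (L): the absolute limit profile (compactness half of Simon's monotone convergence theorem on the
absolute class).** Given the dictionary D (plain `C¹` periodic functions transported to `L²((ℝ/ℤ)^{3N})` with
the right norm, kinetic and potential energies) and the scalar Rellich lemma R, for every measurable monotone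
tower of weights `W m ↑ Winf` on `Config N` whose absolute ground-state energies stay bounded there is a unit
`η ∈ L²((ℝ/ℤ)^{3N})` with `maxFormW Winf L η ≤ ⨆ m, absGroundStateEnergyW (W m) L` (near-minimisers, Rellich,
lower semicontinuity of the kinetic part, Fatou at fixed height, Beppo Levi in the height).
[cite: ReedSimonIV1978, Thm. XIII.64] -/
theorem stub_absLimitProfile :
    (∀ (N : ℕ) (L : ℝ), 0 < L → ∀ Ψ : Config N → ℂ, ContDiff ℝ 1 Ψ → IsTorusPeriodic L Ψ →
      ∃ ηΨ : Lp ℂ 2 (volume : Measure (UnitAddTorus (Fin N × Fin 3))),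
        (∀ᵐ t ∂(volume : Measure (UnitAddTorus (Fin N × Fin 3))),
          (ηΨ : UnitAddTorus (Fin N × Fin 3) → ℂ) t = (cellScale N L : ℂ) * Ψ (fromUnitTorusN L t)) ∧
        ENNReal.ofReal (‖ηΨ‖ ^ 2) = ∫⁻ X in cellN N L, (‖Ψ X‖₊ : ℝ≥0∞) ^ 2 ∧
        maxFormKin L ηΨ = ∫⁻ X in cellN N L, kineticDensity Ψ X ∧
        ∀ W : Config N → ℝ≥0∞, Measurable W →
          maxFormPotW W L ηΨ = ∫⁻ X in cellN N L, W X * (‖Ψ X‖₊ : ℝ≥0∞) ^ 2) →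
    (∀ (N : ℕ) (L : ℝ), 0 < L → ∀ K : ℝ≥0∞, K ≠ ⊤ →
      ∀ f : ℕ → Lp ℂ 2 (volume : Measure (UnitAddTorus (Fin N × Fin 3))),
        (∀ i, ‖f i‖ ≤ 1) → (∀ i, maxFormKin L (f i) ≤ K) →
        ∃ (η : Lp ℂ 2 (volume : Measure (UnitAddTorus (Fin N × Fin 3)))) (φ : ℕ → ℕ),
          StrictMono φ ∧ Tendsto (fun i => f (φ i)) atTop (𝓝 η)) →
    ∀ (N : ℕ) (L : ℝ), 0 < L → ∀ (W : ℕ → Config N → ℝ≥0∞) (Winf : Config N → ℝ≥0∞),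
      (∀ m, Measurable (W m)) → (∀ X, Monotone fun m => W m X) → (∀ X, ⨆ m, W m X = Winf X) →
      (⨆ m, absGroundStateEnergyW (W m) L) ≠ ⊤ →
      ∃ η : Lp ℂ 2 (volume : Measure (UnitAddTorus (Fin N × Fin 3))), ‖η‖ = 1 ∧
        maxFormW Winf L η ≤ ⨆ m, absGroundStateEnergyW (W m) L := by
  intro hD hR N L hL W Winf hWm hmono hsup hE
  set Einf : ℝ≥0∞ := ⨆ m, absGroundStateEnergyW (W m) L with hEinf
  have hEle : ∀ m, absGroundStateEnergyW (W m) L ≤ Einf := fun m =>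
    le_iSup (fun m => absGroundStateEnergyW (W m) L) m
  -- near-minimisers `Ψ m` of the truncated problems on the absolute class
  set δ : ℕ → ℝ≥0∞ := fun n => ((n + 1 : ℕ) : ℝ≥0∞)⁻¹ with hδ
  have hδpos : ∀ n, 0 < δ n := fun n => ENNReal.inv_pos.2 (ENNReal.natCast_ne_top _)
  have hδle : ∀ n, δ n ≤ 1 := fun n => ENNReal.inv_le_one.2 (by exact_mod_cast Nat.succ_pos n)
  have hδlim : Tendsto δ atTop (𝓝 0) :=
    ENNReal.tendsto_inv_nat_nhds_zero.comp (tendsto_add_atTop_nat 1)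
  have hΨex : ∀ m, ∃ Ψ : Config N → ℂ, AbsAdm N L Ψ ∧ absEnergyW (W m) L Ψ < Einf + δ m := by
    intro m
    have h : absGroundStateEnergyW (W m) L < Einf + δ m :=
      (hEle m).trans_lt (ENNReal.lt_add_right hE (hδpos m).ne')
    rw [absGroundStateEnergyW_def] at h
    obtain ⟨Ψ, hΨ⟩ := iInf_lt_iff.1 h
    obtain ⟨hA, hlt⟩ := iInf_lt_iff.1 hΨ
    exact ⟨Ψ, hA, hlt⟩
  choose Ψ hA hΨ using hΨex
  have hC1 : ∀ m, ContDiff ℝ 1 (Ψ m) := fun m => (hA m).1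
  have hper : ∀ m, IsTorusPeriodic L (Ψ m) := fun m => (hA m).2.1
  have hone : ∀ m, ∫⁻ X in cellN N L, (‖Ψ m X‖₊ : ℝ≥0∞) ^ 2 = 1 := fun m => (hA m).2.2
  -- transport to `L²((ℝ/ℤ)^{3N})` through the dictionary D
  have hDm : ∀ m, ∃ ηΨ : Lp ℂ 2 (volume : Measure (UnitAddTorus (Fin N × Fin 3))),
      (∀ᵐ t ∂(volume : Measure (UnitAddTorus (Fin N × Fin 3))),
        (ηΨ : UnitAddTorus (Fin N × Fin 3) → ℂ) t = (cellScale N L : ℂ) * Ψ m (fromUnitTorusN L t)) ∧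
      ENNReal.ofReal (‖ηΨ‖ ^ 2) = ∫⁻ X in cellN N L, (‖Ψ m X‖₊ : ℝ≥0∞) ^ 2 ∧
      maxFormKin L ηΨ = ∫⁻ X in cellN N L, kineticDensity (Ψ m) X ∧
      ∀ W' : Config N → ℝ≥0∞, Measurable W' →
        maxFormPotW W' L ηΨ = ∫⁻ X in cellN N L, W' X * (‖Ψ m X‖₊ : ℝ≥0∞) ^ 2 :=
    fun m => hD N L hL (Ψ m) (hC1 m) (hper m)
  choose f _hae hnorm hkin hpot using hDm
  have hf1 : ∀ m, ‖f m‖ = 1 := by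
    intro m
    have h : ENNReal.ofReal (‖f m‖ ^ 2) = 1 := (hnorm m).trans (hone m)
    have h2 : ‖f m‖ ^ 2 = 1 := ENNReal.ofReal_eq_one.1 h
    exact (pow_eq_one_iff_of_nonneg (norm_nonneg _) two_ne_zero).1 h2
  -- the kinetic energies of the near-minimisers are bounded by `Einf + 1`
  have hkin_le : ∀ m, maxFormKin L (f m) ≤ Einf + 1 := by
    intro m
    rw [hkin m]
    calc ∫⁻ X in cellN N L, kineticDensity (Ψ m) X ≤ absEnergyW (W m) L (Ψ m) := by
          rw [absEnergyW_def]
          exact lintegral_mono fun X => le_self_add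
      _ ≤ Einf + δ m := (hΨ m).le
      _ ≤ Einf + 1 := add_le_add le_rfl (hδle m)
  -- Rellich: an `L²`-convergent subsequence of the transported near-minimisers
  obtain ⟨η, φ, hφ, hconv⟩ := hR N L hL (Einf + 1) (ENNReal.add_ne_top.2 ⟨hE, ENNReal.one_ne_top⟩) f
    (fun i => (hf1 i).le) hkin_le
  -- an a.e.-convergent further subsequence
  obtain ⟨ns, hns, hae⟩ := (tendstoInMeasure_of_tendsto_Lp hconv).exists_seq_tendsto_ae
  set ψ : ℕ → ℕ := φ ∘ ns with hψdef
  have hψ : StrictMono ψ := hφ.comp hns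
  have hconvψ : Tendsto (fun i => f (ψ i)) atTop (𝓝 η) := hconv.comp hns.tendsto_atTop
  have haeψ : ∀ᵐ t ∂(volume : Measure (UnitAddTorus (Fin N × Fin 3))),
      Tendsto (fun i => (f (ψ i) : UnitAddTorus (Fin N × Fin 3) → ℂ) t) atTop
        (𝓝 ((η : UnitAddTorus (Fin N × Fin 3) → ℂ) t)) := hae
  refine ⟨η, ?_, ?_⟩
  · -- `‖η‖ = 1`
    have h1 : Tendsto (fun i => ‖f (ψ i)‖) atTop (𝓝 ‖η‖) := (continuous_norm.tendsto η).comp hconvψ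
    simp only [hf1] at h1
    exact tendsto_nhds_unique h1 tendsto_const_nhds
  · -- the energy bound, first at each FIXED height `m'` of the tower
    have hm : ∀ m' : ℕ, maxFormKin L η + maxFormPotW (W m') L η ≤ Einf := by
      intro m'
      -- lower semicontinuity of the kinetic energy
      have hkin' : maxFormKin L η ≤
          liminf (fun i => ∫⁻ X in cellN N L, kineticDensity (Ψ (ψ i)) X) atTop := by
        refine (maxFormKin_le_liminf L hconvψ).trans_eq ?_
        congr 1
        funext i
        exact hkin (ψ i)
      -- Fatou for the potential energy at height `m'`
      have hpot' : maxFormPotW (W m') L η ≤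
          liminf (fun i => ∫⁻ X in cellN N L, W m' X * (‖Ψ (ψ i) X‖₊ : ℝ≥0∞) ^ 2) atTop := by
        calc maxFormPotW (W m') L η
            = ∫⁻ t, W m' (fromUnitTorusN L t) *
                (‖(η : UnitAddTorus (Fin N × Fin 3) → ℂ) t‖₊ : ℝ≥0∞) ^ 2 := rfl
          _ ≤ ∫⁻ t, liminf (fun i => W m' (fromUnitTorusN L t) *
                (‖(f (ψ i) : UnitAddTorus (Fin N × Fin 3) → ℂ) t‖₊ : ℝ≥0∞) ^ 2) atTop := by
              refine lintegral_mono_ae (haeψ.mono fun t ht => ?_)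
              have hsq : Tendsto (fun i => (‖(f (ψ i) : UnitAddTorus (Fin N × Fin 3) → ℂ) t‖₊ : ℝ≥0∞) ^ 2)
                  atTop (𝓝 ((‖(η : UnitAddTorus (Fin N × Fin 3) → ℂ) t‖₊ : ℝ≥0∞) ^ 2)) :=
                ((ENNReal.continuous_pow 2).tendsto _).comp
                  ((ENNReal.continuous_coe.tendsto _).comp ht.nnnorm)
              rw [← hsq.liminf_eq]
              exact mul_liminf_le _ _
          _ ≤ liminf (fun i => ∫⁻ t, W m' (fromUnitTorusN L t) *
                (‖(f (ψ i) : UnitAddTorus (Fin N × Fin 3) → ℂ) t‖₊ : ℝ≥0∞) ^ 2) atTop :=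
              lintegral_liminf_le' fun i => aemeasurable_weight_integrand (hWm m') L (f (ψ i))
          _ = liminf (fun i => ∫⁻ X in cellN N L, W m' X * (‖Ψ (ψ i) X‖₊ : ℝ≥0∞) ^ 2) atTop := by
              congr 1
              funext i
              exact hpot (ψ i) (W m') (hWm m')
      -- combine and use the near-minimising property along `ψ i ≥ m'` (monotone tower)
      set KINi : ℕ → ℝ≥0∞ := fun i => ∫⁻ X in cellN N L, kineticDensity (Ψ (ψ i)) X with hKINi
      set POTi : ℕ → ℝ≥0∞ := fun i => ∫⁻ X in cellN N L, W m' X * (‖Ψ (ψ i) X‖₊ : ℝ≥0∞) ^ 2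
        with hPOTi
      have hsum : ∀ i, KINi i + POTi i = absEnergyW (W m') L (Ψ (ψ i)) := fun i => by
        simp only [hKINi, hPOTi]
        rw [absEnergyW_def, ← lintegral_add_left (measurable_kineticDensity_any (Ψ (ψ i)))]
      have hev : ∀ᶠ i in atTop, KINi i + POTi i ≤ Einf + δ (ψ i) := by
        filter_upwards [hψ.tendsto_atTop.eventually (eventually_ge_atTop m')] with i hi
        rw [hsum i]
        exact (absEnergyW_mono (fun X => hmono X hi) L (Ψ (ψ i))).trans (hΨ (ψ i)).le
      have hlim : Tendsto (fun i => Einf + δ (ψ i)) atTop (𝓝 Einf) := by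
        have := (tendsto_const_nhds (x := Einf)).add (hδlim.comp hψ.tendsto_atTop)
        rwa [add_zero] at this
      calc maxFormKin L η + maxFormPotW (W m') L η
          ≤ liminf KINi atTop + liminf POTi atTop := add_le_add hkin' hpot'
        _ ≤ liminf (fun i => KINi i + POTi i) atTop := liminf_add_liminf_le_ennreal KINi POTi
        _ ≤ liminf (fun i => Einf + δ (ψ i)) atTop := liminf_le_liminf hev
        _ = Einf := hlim.liminf_eq
    -- Beppo Levi in the height
    have hmeas_m : ∀ m, AEMeasurable (fun t => W m (fromUnitTorusN L t) *
        (‖(η : UnitAddTorus (Fin N × Fin 3) → ℂ) t‖₊ : ℝ≥0∞) ^ 2) volume := fun m =>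
      aemeasurable_weight_integrand (hWm m) L η
    have hsup' : maxFormPotW Winf L η = ⨆ m, maxFormPotW (W m) L η := by
      simp only [maxFormPotW]
      rw [← lintegral_iSup' hmeas_m (Eventually.of_forall fun t => fun m m' h => by
        dsimp only
        gcongr
        exact hmono _ h)]
      refine lintegral_congr fun t => ?_
      rw [← ENNReal.iSup_mul, hsup]
    rw [maxFormW_def, hsup', ENNReal.add_iSup]
    exact iSup_le hm

end Summit.AtomisticToContinuum.BoseEinsteinCondensation.Cruxes.TorusHalfSwapOverlap.TruncationSplit
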